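import Summits.Schanuel.Schanuel.Theorems.RootDecomp1KDescent05

/-!
# RootDecomp1KDescent — lens 1, generation 58, NODE 19 «DESCENT ON THE K-LINE» (Chevalley–Weil 2-descent to an étale double cover, then 2-adic Runge on the cover; RULE K-R49 (iii) payable clause; CLAIM L2723, PRICE L2727, K-R50) — continuation (RootDecomp1KDescent06): §11 TERRITORY of the family DJ λ by tree names (section Territory)

(lens-1 g58 NODE 19 HOME kernel K = HOME/decomp-schanuel-lens-1/g58/Descent.lean 92ee3617…, 1568 l, 121 thm + 32 defs/structures (structure DescentCert, structure EisQ), imports tree …RootDecomp1KRunge06 ONLY = the port of node 18 (no Literature import, no fact def, no private, no set_option, no axiom / instance / sorry / native_decide); Probe / Ctrl0 / Ctrl (56 planted controls, ctrl_table19.txt) + NODE-g58.md + cert58.json/.txt + SHA256SUMS (34 files); CLAIM L2723, writer CHECK NOTE L2724/L2725 (certificate arithmetic reproduced at 13 values of λ), crit g10 EX-ANTE PRICE L2727 (ONE THEOREM ×1 for (A) engine + (B) the class DJ(3^j) + (C) territory JOINTLY iff CHECKLIST K-g58 (1)–(10); RULE K-R50 pre-announced; node-18 label erratum), census LIVENESS-v10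 L2733 (keys k2 / desc2; DJ rows; of record L2735), NODE L2743, critic VERDICT L2746 (crit g10): CLEARED — THEOREM ×1 for (A) engine + (B) the class {DJ 3^j} + (C) territory JOINTLY under RULE K-R49 (iii) («an infinite class of K-R49-territory pairs made unconditional», currency LevelFinite — strictly stronger than the residual ThinFibreAt 2), checklist K-g58 (1)–(10) met, rung 0; labels of record: VARIANT of a KNOWN TOOL (Levin 2008 §3 Thm 6 «Coverings and Runge's method» [corpus:paper:arxiv-0805.1345 p.7]) · PROBLEM-RELATIVE NEW (first descent on the K-line; first members outside every Runge-certifiable class; first LevelFinite for a positive-genus non-uniformised member); RULE K-R50 FIXED (toolkit of record ∪= 2-DESCENT via ℚ-rational 2-torsion of the Jacobian — for k = 2 a factorisation of Δ_x = c₁² − 4c₀c₂ over ℚ, in particular the square type −4·A·B with A + B = c₂ — twists killed by congruences / supports, then any toolkit step upstairs, every further such member / family / presentation / cover degree 2^r / Eisenstein prime / the abstract Descent2At engine ×0-as-record; OPEN TERRITORY at m₀ = 2 := K-R49 territory ∧ Jac has NO ℚ-rational 2-torsion datum — for k = 2 certified by «Δ_x ℚ-irreducible of degree ≡ 2 (mod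 4)»; standing witness W4 (census TM33); UNCONDITIONAL PART ∪= {DJ 3^j} at the currency LevelFinite); PORT GO exactly as census STAGING NOTE 9 L2744 (agreed by the lens L2745) with the edits (a) + (b) SANCTIONED. Port by census-1 gen 23 as `RootDecomp1KDescent01–06` (`--supports stmt-Schanuel-33364`; no census credit): 01 = §0 small facts, §1 the curves `dsP Q A = x²·Q(Y) + (2x+1)·A(Y)` (`dsC`, `bev_dsP`), §2 the level equation in integers, §3 the Eisenstein form of `F_Q` (`structure EisQ`) and the homogenised `Y⁶`-identity, §4 THE DESCENT LEMMA (`twist_mod_eight`, `twist_support`, `twist_kill`, `twist_le`, **`descent`**); 02 = §5 the 2-adic Runge step on the double cover (`exists_sign_small`, ultrametric bookkeeping in ℂ₂), §6 `structure DescentCert Q A` (integral data + identities only) and the integer `dsI`; 03 = §7 the lift of a level point to the cover read in ℂ₂ (‖I‖₂ ≤ (2/‖D‖₂)·2^{−3·N!} for one sign), §8 the norm `dsNu`, the archimedean size of `I`, the endgame (`endgame_ds`, cost 5 < 6 = 2μ); 04 = §9 THE ENGINE **`levelFinite_of_descentCert : DescentCert Q A → LevelFinite (dsP Q A)`** and `thinFibreAt_of_descentCert`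 (every m₀); 05 = §10 THE FAMILY `DJ λ` (`djQ = Y⁴+3Y³+3Y²+3`, `djA`, `DJ`), ONE certificate `djCert j` polynomial in λ = 3^j, **`levelFinite_DJ : ∀ j, LevelFinite (DJ (3^j))`**, **`thinFibreAt_DJ : ∀ j m₀, ThinFibreAt m₀ (DJ (3^j))`** HYPOTHESIS-FREE, `DJ_injective`, named members `DJ1` `DJ3` `DJ9`; 06 = §11 TERRITORY (section Territory) by tree names: `isEisensteinAt_djQ`, irreducibility of the top over ℚ, **`DJ_territory`**, the named members' territory. PORT EDITS: (a) 16 one-line docstrings quoting the signature on the undocumented decls (`dsC_two` / `dsC_one` / `dsC_zero` / `dsC_of_gt`, `natDegree_djA_le`, `natDegree_djT_le`, `natDegree_djF0_le` … `natDegree_djF3_le`, `levelFinite_DJ1/3/9`, `thinFibreAt_two_DJ1/3/9`); (b) PRIVATISATION ×5 of one-liners that the head dry-run flagged as near-duplicates of foreign / out-of-cone declarations — `odd_three_pow` (≡ a Crystal3D decl), `norm_intCast_le_one_ds` (≡ a BirchSwinnertonDyer decl; tree-private twins in Runge01 / LocalExponent01), `eight_dvd_sq_sub_one_ds` (≡ a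 HodgeConjecture decl), `isCoprime_num_den_ds` (≡ `Literature.NumberTheory.DiophantineApproximation.isCoprime_num_den`, not in the import cone), `odd_psNumer_ds` (≡ `RootDecomp1KCollarCell.odd_psNumer_two`, same summit but outside the cone — importing CollarCell02 would add 53 modules) — with file-local private copies re-emitted where a later part uses them (03: `norm_intCast_le_one_ds`, `odd_three_pow`; 04: `isCoprime_num_den_ds`, `odd_psNumer_ds`; 05: `odd_three_pow`); nothing else (no deletion, no replacement, no import added, no set_option; K's three `@[simp]` kept); provenance doc blocks + continuation headers = K's own open-lines; statements and proofs VERBATIM. Rung 0 — nothing here proves Schanuel, 33364, 33363, 31077 or ThinFibre 2; everything HYPOTHESIS-FREE.)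
-/

noncomputable section

namespace Summit.Schanuel.Schanuel.Theorems.RootDecomp1KDescent

open Polynomial LiouvilleNumber
open scoped Nat
open Summit.Schanuel.Schanuel.Theorems.RootDecomp1KTwoBaseCell (psNumer partialSum_eq_psNumer_div coprime_psNumer)
open Summit.Schanuel.Schanuel.Theorems.RootDecomp1KRelLiouvilleCell (partialSum_two_strictMono)
open Summit.Schanuel.Schanuel.Theorems.RootDecomp1KDegreeLadder
open Summit.Schanuel.Schanuel.Theorems.RootDecomp1KXLinear
open Summit.Schanuel.Schanuel.Theorems.RootDecomp1KXLinearII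
open Summit.Schanuel.Schanuel.Theorems.RootDecomp1KXTop
open Summit.Schanuel.Schanuel.Theorems.RootDecomp1KXAll
open Summit.Schanuel.Schanuel.Theorems.RootDecomp1KLevelFinite
open Summit.Schanuel.Schanuel.Theorems.RootDecomp1KThueMahler
open Summit.Schanuel.Schanuel.Theorems.RootDecomp1KParamThueMahler
open Summit.Schanuel.Schanuel.Theorems.RootDecomp1KLocalExponent
open Summit.Schanuel.Schanuel.Theorems.RootDecomp1KRunge

/-! ### §11 TERRITORY of the family `DJ λ`, uniformly in `λ`, by TREE names (checklist K-g58 (5))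

`x`-degree 2, `Y`-degree 4 `= 2·xdeg` (NOT `<`: outside node 12's height shape), top `x`-coefficient `Q = Y⁴+3Y³+3Y²+3`
IRREDUCIBLE over `ℚ` (3-Eisenstein + Gauss) of full degree `deg Q = deg_Y P`, with a `ℚ₂`-root (Hensel at `1`) and no
rational root, separable, `eTop = 0`, rate 1 (`c₁(β) = 2A_λ(β) = −2λ²β⁶ ≠ 0` at every root `β` of `Q`, any field of
characteristic 0); `¬ DecidedAt 2`, `¬ LocalAt 2`, `¬ GaussAt m₀` (any `m₀`), `¬ XLinTM`, `¬ XLinearLt`, no x-linear /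
two-term / norm-shape presentation, `3 ≤ thinThreshold`; IN `SepTopAt 2` (conditional of record via node 11 ⟸
`PadicSubspace` — bypassed here, NOT proved); NOT Runge-certifiable at `m₀ = 2` in the sense of K-R49 (ii) (typed:
`Irreducible (topX P) over ℚ ∧ deg (topX P) = deg_Y P ∧ ¬ deg_Y P < 2·xdeg P` — one Galois orbit of places over `x = ∞`,
no auxiliary Runge function on the curve itself).  MEMO (not typed): `DJ λ` is not `XParamTM`-certified either (the curve
`w² = −A_λ·(Q − A_λ)` has genus 3 for the named members; no rational parametrisation). -/

section Territory

open Summit.Schanuel.Schanuel.Theorems.RootDecomp1KIntegrality (GaussAt gaussAt_xPolyP_iff)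
open Summit.Schanuel.Schanuel.Theorems.RootDecomp1KSubspaceBranch (SepTopAt)

/-- `P_λ(x, y) = x²·Q(y) + (2x+1)·A_λ(y)`. -/
theorem bev_DJ (l : ℤ) (x y : ℝ) : bev (DJ l) x y = x ^ 2 * aeval y djQ + (2 * x + 1) * aeval y (djA l) := by
  rw [DJ, bev_dsP]

/-- `: djQ.natDegree = 4`. -/
theorem natDegree_djQ : djQ.natDegree = 4 := eisQ_djQ.deg
/-- `: djQ.Monic`. -/
theorem monic_djQ : djQ.Monic := by unfold djQ; monicity!
/-- `: djQ ≠ 0`. -/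
theorem djQ_ne_zero : djQ ≠ 0 := monic_djQ.ne_zero

/-- `Q = Y⁴ + 3Y³ + 3Y² + 3` is EISENSTEIN at `3`. -/
theorem isEisensteinAt_djQ : djQ.IsEisensteinAt (Ideal.span {(3 : ℤ)}) := by
  refine ⟨?_, fun {n} hn => ?_, ?_⟩
  · rw [monic_djQ.leadingCoeff, Ideal.mem_span_singleton]; norm_num
  · rw [natDegree_djQ] at hn
    rw [Ideal.mem_span_singleton]
    interval_cases n <;> simp [djQ]
  · rw [Ideal.span_singleton_pow, Ideal.mem_span_singleton]; simp [djQ]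

/-- … hence irreducible in `ℤ[Y]` (Mathlib `IsEisensteinAt.irreducible`; `Q` is monic, so primitive) … -/
theorem irreducible_djQ : Irreducible djQ :=
  isEisensteinAt_djQ.irreducible ((Ideal.span_singleton_prime (by norm_num)).mpr Int.prime_three)
    monic_djQ.isPrimitive (by rw [natDegree_djQ]; norm_num)

/-- … hence IRREDUCIBLE OVER `ℚ` (GAUSS's lemma, Mathlib `Monic.irreducible_iff_irreducible_map_fraction_map`). -/
theorem irreducible_djQ_rat : Irreducible (djQ.map (Int.castRingHom ℚ)) := by
  rw [← algebraMap_int_eq]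
  exact (monic_djQ.irreducible_iff_irreducible_map_fraction_map).mp irreducible_djQ

/-- … hence separable over `ℚ`. -/
theorem separable_djQ_rat : (djQ.map (Int.castRingHom ℚ)).Separable := irreducible_djQ_rat.separable

/-- … hence NO RATIONAL ROOT (an irreducible quartic has no linear factor). -/
theorem aeval_djQ_ne_zero_rat (q : ℚ) : aeval q djQ ≠ 0 := by
  intro h
  have hroot : IsRoot (djQ.map (Int.castRingHom ℚ)) q := by
    rw [IsRoot.def, eval_map, ← algebraMap_int_eq, ← aeval_def, h]
  have h1 := degree_eq_one_of_irreducible_of_root irreducible_djQ_rat hroot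
  have h4 : (djQ.map (Int.castRingHom ℚ)).degree = 4 := by
    rw [degree_map_eq_of_injective (Int.castRingHom ℚ).injective_int, degree_eq_natDegree djQ_ne_zero, natDegree_djQ]
    rfl
  rw [h4] at h1
  exact absurd h1 (by decide)

/-- `Q` HAS A ROOT IN `ℚ₂` (indeed in `ℤ₂`): HENSEL at `a = 1`, `‖Q(1)‖₂ = ‖10‖₂ = 1/2 < 1 = ‖Q'(1)‖₂² = ‖19‖₂²`. -/
theorem exists_padic_root_djQ : ∃ z : ℚ_[2], aeval z djQ = 0 := by
  have hF : ‖aeval (1 : ℤ_[2]) djQ‖ < ‖aeval (1 : ℤ_[2]) (derivative djQ)‖ ^ 2 := by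
    have e1 : aeval (1 : ℤ_[2]) djQ = ((10 : ℤ) : ℤ_[2]) := by simp [djQ, map_ofNat]; norm_num
    have e2 : aeval (1 : ℤ_[2]) (derivative djQ) = ((19 : ℤ) : ℤ_[2]) := by simp [djQ, map_ofNat]; norm_num
    rw [e1, e2]
    have h19 : ‖((19 : ℤ) : ℤ_[2])‖ = 1 := by
      refine le_antisymm (PadicInt.norm_le_one _) (not_lt.mp fun h => ?_)
      have := (PadicInt.norm_int_lt_one_iff_dvd _).mp h
      omega
    have h10 : ‖((10 : ℤ) : ℤ_[2])‖ < 1 := (PadicInt.norm_int_lt_one_iff_dvd _).mpr (by norm_num)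
    rw [h19, one_pow]; exact h10
  obtain ⟨z, hz, -⟩ := hensels_lemma hF
  refine ⟨(z : ℚ_[2]), ?_⟩
  have := Polynomial.aeval_algebraMap_apply ℚ_[2] z djQ
  rw [hz, map_zero] at this
  simpa using this

/-- the top `Q` is REFUSED by node 14's root condition at `m₀ ≤ 2` (irrational simple `ℚ₂`-root; tree
`not_rootCond_of_padic_root`). -/
theorem not_rootCond_djQ {m₀ : ℕ} (hm : m₀ ≤ 2) : ¬ RootCond m₀ djQ := by
  obtain ⟨z, hz⟩ := exists_padic_root_djQ
  exact not_rootCond_of_padic_root djQ djQ_ne_zero hz aeval_djQ_ne_zero_rat hm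

/-- `: dsC djQ (djA l) 2 ≠ 0`. -/
theorem dsC_dj_two_ne_zero (l : ℤ) : dsC djQ (djA l) 2 ≠ 0 := by rw [dsC_two]; exact djQ_ne_zero
/-- `(l : ℤ) : xdeg (DJ l) = 2`. -/
theorem xdeg_DJ (l : ℤ) : xdeg (DJ l) = 2 := xdeg_xPolyP 2 _ (dsC_dj_two_ne_zero l)
/-- `(l : ℤ) : topX (DJ l) = djQ` — the top `x`-coefficient is `Q`, for every `λ`. -/
theorem topX_DJ (l : ℤ) : topX (DJ l) = djQ := by
  rw [DJ, dsP, topX_xPolyP 2 _ (dsC_dj_two_ne_zero l), dsC_two]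
/-- `(l : ℤ) (j : ℕ) : xCoeff (DJ l) j = dsC djQ (djA l) j`. -/
theorem xCoeff_DJ (l : ℤ) (j : ℕ) : xCoeff (DJ l) j = dsC djQ (djA l) j := by
  rw [DJ, dsP, xCoeff_xPolyP]
  split_ifs with h
  · rfl
  · exact (dsC_of_gt _ _ (by omega)).symm
/-- `(l : ℤ) : xCoeff (DJ l) 1 = 2 * djA l` — the `x¹`-coefficient `c₁ = 2A_λ`. -/
theorem xCoeff_DJ_one (l : ℤ) : xCoeff (DJ l) 1 = 2 * djA l := by rw [xCoeff_DJ, dsC_one]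
/-- `(l : ℤ) : 4 ≤ (DJ l).natDegree` (the `Y⁴x²` coefficient is `1`). -/
theorem four_le_natDegree_DJ (l : ℤ) : 4 ≤ (DJ l).natDegree := by
  refine le_natDegree_of_ne_zero fun h => ?_
  have h1 := congrArg (fun q : ℤ[X] => q.coeff 2) h
  simp only [DJ, dsP, coeff_coeff_xPolyP, coeff_zero] at h1
  rw [if_pos (by simp), dsC_two, eisQ_djQ.lead] at h1
  exact one_ne_zero h1
/-- `(l : ℤ) : (DJ l).natDegree = 4`. -/
theorem natDegree_DJ (l : ℤ) : (DJ l).natDegree = 4 := by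
  refine le_antisymm (natDegree_xPolyP_le 2 _ 4 fun j hj => ?_) (four_le_natDegree_DJ l)
  interval_cases j
  · rw [dsC_zero]; exact (natDegree_djA_le l).trans (by norm_num)
  · rw [dsC_one, djA]; compute_degree; norm_num
  · rw [dsC_two, natDegree_djQ]
/-- `(l : ℤ) : DJ l ≠ 0`. -/
theorem DJ_ne_zero (l : ℤ) : DJ l ≠ 0 := fun h => by
  have := four_le_natDegree_DJ l; rw [h, natDegree_zero] at this; omega
/-- `(l : ℤ) : eTop (DJ l) = 0` — FULL-DEGREE top: `deg_Y Q = deg_Y P`. -/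
theorem eTop_DJ (l : ℤ) : eTop (DJ l) = 0 := by rw [eTop, natDegree_DJ, topX_DJ, natDegree_djQ]
/-- `(l : ℤ) : (topX (DJ l)).natDegree = (DJ l).natDegree`. -/
theorem natDegree_topX_DJ (l : ℤ) : (topX (DJ l)).natDegree = (DJ l).natDegree := by
  rw [topX_DJ, natDegree_djQ, natDegree_DJ]
/-- `(l : ℤ) : ¬ (DJ l).natDegree < 2 * xdeg (DJ l)` — OUTSIDE node 12's height shape (`4 = 2·2`). -/
theorem not_natDegree_DJ_lt (l : ℤ) : ¬ (DJ l).natDegree < 2 * xdeg (DJ l) := by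
  rw [natDegree_DJ, xdeg_DJ]; norm_num

/-- RATE 1, TYPED: at every root `β` of the top `Q` (in any field of characteristic `0`) the `x¹`-coefficient does not
vanish: `c₁(β) = 2A_λ(β) = −2λ²β⁶ ≠ 0` (`A_λ = λ²(QT − Y⁶)` and `Q(0) = 3 ≠ 0`), `λ ≠ 0`. -/
theorem aeval_xCoeff_one_ne_zero_of_root {l : ℤ} (hl : l ≠ 0) (K : Type) [Field K] [CharZero K] (β : K)
    (hβ : aeval β (topX (DJ l)) = 0) : aeval β (xCoeff (DJ l) 1) ≠ 0 := by
  rw [topX_DJ] at hβ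
  have hβ0 : β ≠ 0 := by
    rintro rfl
    simp [djQ, map_ofNat] at hβ
  have hT := congrArg (aeval β) (dj_hT l)
  simp only [map_add, map_mul, map_pow, map_intCast, aeval_X, hβ, mul_zero, zero_mul] at hT
  have hA : aeval β (djA l) = -((l : K) ^ 2 * β ^ 6) := by linear_combination hT
  rw [xCoeff_DJ_one, map_mul, map_ofNat, hA]
  have hlK : (l : K) ≠ 0 := Int.cast_ne_zero.mpr hl
  exact mul_ne_zero two_ne_zero (neg_ne_zero.mpr (mul_ne_zero (pow_ne_zero _ hlK) (pow_ne_zero _ hβ0)))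

/-- `DJ λ` has NO x-linear presentation (second difference of `P_λ(x, 0) = 3x² + 18λ²(2x+1)` in `x` is `6 ≠ 0`). -/
theorem DJ_ne_xLinP (l : ℤ) (A B : ℤ[X]) : DJ l ≠ xLinP A B := by
  intro hP
  have h := fun x : ℝ => congrArg (fun Q => bev Q x 0) hP
  have h0 := h 0
  have h1 := h 1
  have h2 := h 2
  simp only [bev_DJ, bev_xLinP] at h0 h1 h2
  have hq : aeval (0 : ℝ) djQ = 3 := by simp [djQ, map_ofNat]
  rw [hq] at h0 h1 h2
  have : (6 : ℝ) = 0 := by linear_combination h0 - 2 * h1 + h2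
  norm_num at this
/-- `(l : ℤ) : ¬ XLinearLt (DJ l)`. -/
theorem not_xLinearLt_DJ (l : ℤ) : ¬ XLinearLt (DJ l) := fun ⟨A, B, _, _, hP⟩ => DJ_ne_xLinP l A B hP
/-- outside node 16's record class (x-linear by statement). -/
theorem not_xLinTM_DJ (l : ℤ) : ¬ XLinTM (DJ l) := fun ⟨A, B, _, _, _, _, hP⟩ => DJ_ne_xLinP l A B hP
/-- not a conjugate-poles norm shape of node 10 (those are x-linear). -/
theorem DJ_ne_normShapeCurve (l : ℤ) (g q : ℤ[X]) (n : ℕ) (D : ℤ) : DJ l ≠ normShapeCurve g q n D := by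
  rw [normShapeCurve_eq_xLinP]; exact DJ_ne_xLinP l _ _
/-- not a two-term curve `x^k·B(Y) − A(Y)` (`λ ≠ 0`: the `x`-support of `DJ λ` is `{0, 1, 2}`). -/
theorem DJ_ne_twoTermP {l : ℤ} (hl : l ≠ 0) (k : ℕ) (B A : ℤ[X]) : DJ l ≠ twoTermP k B A := by
  intro h
  have hc : ∀ i j : ℕ, (if j ∈ Finset.range 3 then (dsC djQ (djA l) j).coeff i else 0) =
      ((if j = k then B.coeff i else 0) - (if j = 0 then A.coeff i else 0)) := by
    intro i j
    rw [← coeff_coeff_xPolyP, ← coeff_coeff_twoTermP, ← h]; rfl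
  by_cases hk : k = 1
  · subst hk
    have h02 := hc 0 2
    rw [if_pos (by simp), if_neg (by norm_num), if_neg (by norm_num), dsC_two] at h02
    simp [djQ] at h02
  · have h01 := hc 0 1
    rw [if_pos (by simp), if_neg (fun h => hk h.symm), if_neg (by norm_num), dsC_one, coeff_zero_eq_eval_zero] at h01
    simp [djA] at h01
    exact hl h01
/-- in EVERY presentation `DJ λ = Σ_{j ≤ k} x^j c_j(Y)` the top has a `ℚ₂`-root (it is `Q` or `0`). -/
theorem exists_padic_root_top_of_DJ_eq (l : ℤ) (k : ℕ) (c : ℕ → ℤ[X]) (h : DJ l = xPolyP k c) :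
    ∃ z : ℚ_[2], aeval z (c k) = 0 := by
  by_cases hck : c k = 0
  · exact ⟨0, by rw [hck, map_zero]⟩
  · have h1 := topX_DJ l
    rw [h, topX_xPolyP k c hck] at h1
    rw [h1]; exact exists_padic_root_djQ
/-- `(l : ℤ) (e : ℕ) : ¬ RootlessTop e (DJ l)`. -/
theorem not_rootlessTop_DJ (l : ℤ) (e : ℕ) : ¬ RootlessTop e (DJ l) := by
  rintro ⟨k, c, -, hroot, h⟩
  obtain ⟨z, hz⟩ := exists_padic_root_top_of_DJ_eq l k c h
  exact hroot z hz
/-- **`¬ DecidedAt 2 (DJ λ)`** — each of the five disjuncts of the record's decided class refuted. -/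
theorem not_decidedAt_two_DJ (l : ℤ) : ¬ DecidedAt 2 (DJ l) := by
  rintro (h | h | h | h | h)
  · have := four_le_natDegree_DJ l; omega
  · exact not_xLinearLt_DJ l h
  · exact absurd h.1 (by norm_num)
  · have := three_le_thinThreshold (DJ l); omega
  · exact not_rootlessTop_DJ l 1 h
/-- **`¬ LocalAt m₀ (DJ λ)` for `m₀ ≤ 2`** (tree `rootCond_topX_of_localAt` + `not_rootCond_djQ`). -/
theorem not_localAt_DJ (l : ℤ) {m₀ : ℕ} (hm : m₀ ≤ 2) : ¬ LocalAt m₀ (DJ l) := fun h => by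
  have hR := rootCond_topX_of_localAt h
  rw [topX_DJ] at hR
  exact not_rootCond_djQ hm hR
/-- **`¬ GaussAt m₀ (DJ λ)`** at ANY `m₀` (dominance fails at `j = 1`: `deg c₁ = deg 2A_λ = deg c₀`). -/
theorem not_gaussAt_DJ (l : ℤ) (m₀ : ℕ) : ¬ GaussAt m₀ (DJ l) := by
  intro h
  have := ((gaussAt_xPolyP_iff 2 (dsC djQ (djA l)) (dsC_dj_two_ne_zero l)).mp h).1 1 le_rfl (by norm_num)
  rw [dsC_one, dsC_zero, show (2 : ℤ[X]) = C 2 by simp [map_ofNat], natDegree_C_mul (by norm_num)] at this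
  exact lt_irrefl _ this
/-- … while `DJ λ` IS in node 11's CONDITIONAL class at `m₀ = 2` (separable top, `eTop = 0`; HONEST: conditional of
record via `PadicSubspace`, which is NOT proved here — the descent BYPASSES it). -/
theorem sepTopAt_two_DJ (l : ℤ) : SepTopAt 2 (DJ l) := by
  refine ⟨?_, ?_⟩
  · rw [topX_DJ]; exact separable_djQ_rat
  · rw [eTop_DJ]; norm_num

/-- **TERRITORY of `DJ λ` for every `λ ≠ 0`, by tree names** (everything except the finiteness, which needs `λ = 3^j`). -/
theorem DJ_territory_of_ne_zero {l : ℤ} (hl : l ≠ 0) :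
    xdeg (DJ l) = 2 ∧ (DJ l).natDegree = 4 ∧ topX (DJ l) = djQ ∧
      Irreducible ((topX (DJ l)).map (Int.castRingHom ℚ)) ∧ (topX (DJ l)).natDegree = (DJ l).natDegree ∧
      ¬ (DJ l).natDegree < 2 * xdeg (DJ l) ∧
      (∃ z : ℚ_[2], aeval z (topX (DJ l)) = 0) ∧ (∀ q : ℚ, aeval q (topX (DJ l)) ≠ 0) ∧
      ((topX (DJ l)).map (Int.castRingHom ℚ)).Separable ∧ eTop (DJ l) = 0 ∧
      (∀ (K : Type) [Field K] [CharZero K] (β : K), aeval β (topX (DJ l)) = 0 → aeval β (xCoeff (DJ l) 1) ≠ 0) ∧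
      ¬ DecidedAt 2 (DJ l) ∧ ¬ LocalAt 2 (DJ l) ∧ (∀ m₀, ¬ GaussAt m₀ (DJ l)) ∧ ¬ XLinTM (DJ l) ∧ ¬ XLinearLt (DJ l) ∧
      (∀ A B, DJ l ≠ xLinP A B) ∧ (∀ k B A, DJ l ≠ twoTermP k B A) ∧ (∀ g q n D, DJ l ≠ normShapeCurve g q n D) ∧
      3 ≤ thinThreshold (DJ l) ∧ SepTopAt 2 (DJ l) := by
  refine ⟨xdeg_DJ l, natDegree_DJ l, topX_DJ l, ?_, natDegree_topX_DJ l, not_natDegree_DJ_lt l, ?_, ?_, ?_, eTop_DJ l,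
    aeval_xCoeff_one_ne_zero_of_root hl, not_decidedAt_two_DJ l, not_localAt_DJ l le_rfl, not_gaussAt_DJ l,
    not_xLinTM_DJ l, not_xLinearLt_DJ l, DJ_ne_xLinP l, DJ_ne_twoTermP hl, DJ_ne_normShapeCurve l,
    three_le_thinThreshold _, sepTopAt_two_DJ l⟩
  · rw [topX_DJ]; exact irreducible_djQ_rat
  · rw [topX_DJ]; exact exists_padic_root_djQ
  · rw [topX_DJ]; exact aeval_djQ_ne_zero_rat
  · rw [topX_DJ]; exact separable_djQ_rat

/-- EVERY rational fibre of `DJ λ` is NON-DEGENERATE (`Q(r) ≠ 0`: no rational root) — so the non-degeneracy proviso of the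
tree's `levels_finite_of_nondeg` / of `LevelSet` is automatic for the family: `LevelFinite (DJ λ)` is about ALL level points
of bounded height. -/
theorem DJ_nondeg (l : ℤ) (r : ℚ) : ∃ x : ℝ, bev (DJ l) x r ≠ 0 := by
  by_cases hA : aeval (r : ℝ) (djA l) = 0
  · refine ⟨1, ?_⟩
    rw [bev_DJ, hA, mul_zero, add_zero, one_pow, one_mul, ← aeval_ratCast djQ r]
    exact_mod_cast aeval_djQ_ne_zero_rat r
  · exact ⟨0, by rw [bev_DJ]; simpa using hA⟩
/-- … hence the level set of `DJ λ` below height `C` is `{N | ∃ r, |r| ≤ C ∧ P_λ(s_N, r) = 0}` — no proviso. -/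
theorem levelSet_DJ (l : ℤ) (C : ℝ) :
    LevelSet (DJ l) C = {N | ∃ r : ℚ, |(r : ℝ)| ≤ C ∧ bev (DJ l) (partialSum 2 N) r = 0} := by
  ext N
  simp only [LevelSet, Set.mem_setOf_eq]
  exact ⟨fun ⟨r, h1, h2, _⟩ => ⟨r, h1, h2⟩, fun ⟨r, h1, h2⟩ => ⟨r, h1, h2, DJ_nondeg l r⟩⟩
/-- **FINITELY MANY LEVEL POINTS OF BOUNDED HEIGHT, with no proviso**: for every `C`, only finitely many truncations `s_N`
of `ℓ₂` are `x`-coordinates of rational points `(s_N, r)`, `|r| ≤ C`, of `DJ 3^j = 0`. -/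
theorem levels_DJ_finite (j : ℕ) (C : ℝ) :
    {N : ℕ | ∃ r : ℚ, |(r : ℝ)| ≤ C ∧ bev (DJ ((3 : ℤ) ^ j)) (partialSum 2 N) r = 0}.Finite := by
  rw [← levelSet_DJ]; exact levelFinite_DJ j C

/-- `(j : ℕ) : ((3 : ℤ) ^ j) ≠ 0`. -/
theorem three_pow_ne_zero_ds (j : ℕ) : ((3 : ℤ) ^ j) ≠ 0 := pow_ne_zero _ (by norm_num)

/-- **THE INFINITE CLASS `DJ 3^j` OF K-R49-TERRITORY PAIRS MADE UNCONDITIONAL — TERRITORY AND THE THEOREM, uniformly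
in `j`, by tree names:** `x`-degree 2, `Y`-degree 4 `= 2·xdeg` (not `<`), top `Q` IRREDUCIBLE over `ℚ` of FULL degree
(`deg Q = deg_Y P`, `eTop = 0`) — so NOT Runge-certifiable at `m₀ = 2` in the sense of K-R49 (ii) — with a `ℚ₂`-root
and no rational root, separable, rate 1 at every root of the top; `¬ DecidedAt 2`, `¬ LocalAt 2`, `¬ GaussAt m₀`,
`¬ XLinTM`, `¬ XLinearLt`, not x-linear / two-term / norm shape, `3 ≤ thinThreshold`; IN the conditional class
`SepTopAt 2` (bypassed) — AND NOW `LevelFinite (DJ 3^j)`, hence `ThinFibreAt m₀ (DJ 3^j)` for EVERY `m₀`,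
HYPOTHESIS-FREE, from ONE descent certificate polynomial in `λ`. -/
theorem DJ_territory (j : ℕ) :
    xdeg (DJ ((3 : ℤ) ^ j)) = 2 ∧ (DJ ((3 : ℤ) ^ j)).natDegree = 4 ∧ topX (DJ ((3 : ℤ) ^ j)) = djQ ∧
      Irreducible ((topX (DJ ((3 : ℤ) ^ j))).map (Int.castRingHom ℚ)) ∧
      (topX (DJ ((3 : ℤ) ^ j))).natDegree = (DJ ((3 : ℤ) ^ j)).natDegree ∧
      ¬ (DJ ((3 : ℤ) ^ j)).natDegree < 2 * xdeg (DJ ((3 : ℤ) ^ j)) ∧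
      (∃ z : ℚ_[2], aeval z (topX (DJ ((3 : ℤ) ^ j))) = 0) ∧ (∀ q : ℚ, aeval q (topX (DJ ((3 : ℤ) ^ j))) ≠ 0) ∧
      ((topX (DJ ((3 : ℤ) ^ j))).map (Int.castRingHom ℚ)).Separable ∧ eTop (DJ ((3 : ℤ) ^ j)) = 0 ∧
      (∀ (K : Type) [Field K] [CharZero K] (β : K),
        aeval β (topX (DJ ((3 : ℤ) ^ j))) = 0 → aeval β (xCoeff (DJ ((3 : ℤ) ^ j)) 1) ≠ 0) ∧
      ¬ DecidedAt 2 (DJ ((3 : ℤ) ^ j)) ∧ ¬ LocalAt 2 (DJ ((3 : ℤ) ^ j)) ∧ (∀ m₀, ¬ GaussAt m₀ (DJ ((3 : ℤ) ^ j))) ∧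
      ¬ XLinTM (DJ ((3 : ℤ) ^ j)) ∧ ¬ XLinearLt (DJ ((3 : ℤ) ^ j)) ∧
      (∀ A B, DJ ((3 : ℤ) ^ j) ≠ xLinP A B) ∧ (∀ k B A, DJ ((3 : ℤ) ^ j) ≠ twoTermP k B A) ∧
      (∀ g q n D, DJ ((3 : ℤ) ^ j) ≠ normShapeCurve g q n D) ∧
      3 ≤ thinThreshold (DJ ((3 : ℤ) ^ j)) ∧ SepTopAt 2 (DJ ((3 : ℤ) ^ j)) ∧
      LevelFinite (DJ ((3 : ℤ) ^ j)) ∧ ∀ m₀, ThinFibreAt m₀ (DJ ((3 : ℤ) ^ j)) := by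
  obtain ⟨h1, h2, h3, h4, h5, h6, h7, h8, h9, h10, h11, h12, h13, h14, h15, h16, h17, h18, h19, h20, h21⟩ :=
    DJ_territory_of_ne_zero (three_pow_ne_zero_ds j)
  exact ⟨h1, h2, h3, h4, h5, h6, h7, h8, h9, h10, h11, h12, h13, h14, h15, h16, h17, h18, h19, h20, h21,
    levelFinite_DJ j, thinFibreAt_DJ j⟩

/-- the NAMED MEMBERS' territory + theorem (`DJ1 = DJ 3⁰`, `DJ3`, `DJ9`): instances of `DJ_territory`. -/
theorem DJ1_territory : ¬ DecidedAt 2 DJ1 ∧ ¬ LocalAt 2 DJ1 ∧ ¬ GaussAt 2 DJ1 ∧ ¬ XLinTM DJ1 ∧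
    Irreducible ((topX DJ1).map (Int.castRingHom ℚ)) ∧ (topX DJ1).natDegree = DJ1.natDegree ∧
    ¬ DJ1.natDegree < 2 * xdeg DJ1 ∧ LevelFinite DJ1 ∧ ThinFibreAt 2 DJ1 := by
  obtain ⟨-, -, -, h4, h5, h6, -, -, -, -, -, h12, h13, h14, h15, -, -, -, -, -, -, h22, h23⟩ := DJ_territory 0
  exact ⟨h12, h13, h14 2, h15, h4, h5, h6, h22, h23 2⟩

end Territory

end Summit.Schanuel.Schanuel.Theorems.RootDecomp1KDescent

end
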